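import Literature.NumberTheory.DiophantineGeometry.ShuteFourSquareful
import Literature.Algebra.EuclideanLattices.CoprimeLatticePointsEllipse

/-!
# Shute (2021), §5: the main count `N(B)` through the parameters, Möbius reinsertion of the coprimality condition, and the final choice `D = B^{4/245}`

Third companion to `ShuteFourSquareful.lean` (named fact
`Literature.NumberTheory.DiophantineGeometry.Shute2021_theorem11` = Theorem 1.1 of A. Shute,
*Sums of four squareful numbers*, arXiv:2104.06966: `N(B) = cB + O_ε(B^{734/735+ε})`, `c > 0`).
Everything here is PROVED; the file formalizes the parts of the deduction of Theorem 1.1 (§5 of the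
paper) that do not involve the circle method:

* **`𝐳 ↔ (𝐱, 𝐲)`** (§1, (1.5); §5, notation). The vectors `𝐳` of nonzero squareful integers with
  `|zᵢ| ≤ B` and any property `Q` are in bijection with the parameters `(𝐱, 𝐲)`, `xᵢ ≥ 1`,
  `yᵢ ≠ 0` square-free, `|yᵢ³xᵢ²| ≤ B`, whose vector `(yᵢ³xᵢ²)ᵢ` has `Q`
  (`Shute2021.card_filter_squareful_eq_card_params`); under this bijection `z₁z₂z₃z₄ = □` iff
  `y₁y₂y₃y₄ = □` (`Shute2021.isSquare_prod_toZ_iff`) and `gcd(𝐳) = 1` iff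
  `gcd(x₁y₁, …, x₄y₄) = 1` (`Shute2021.isPrimitive_toZ_iff`). Hence the parameter forms of
  `N(B)` and `N(D, B)` (`Shute2021.mainCount_eq_card_params`,
  `Shute2021.mainCountTrunc_eq_card_params`): eq. (1.5) of the paper up to its sign bookkeeping
  (the paper lets `xᵢ` range over `ℤ_{≠0}` and divides by `16`).
* **Lemma 5.2 (reinsertion of the coprimality condition), corrected form.**
  `N(D, B) = Σ_{d ≤ B} μ(d) · #{(𝐱, 𝐲) : …, d ∣ yᵢ³xᵢ² ∀ i}` (`Shute2021.mainCountTrunc_eq_sum_moebius`)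
  and, since only square-free `d` contribute and then `d ∣ y³x² ⟺ (d / gcd(d, |y|)) ∣ x`
  (`Shute2021.natCast_dvd_pow_three_mul_sq_iff`), the form after the substitution `xᵢ ↦ sᵢxᵢ`,
  `sᵢ = d / gcd(d, |yᵢ|)` (`Shute2021.mainCountTrunc_eq_sum_moebius_squarefree`).
  *Erratum.* The paper inserts `gcd(z₁, …, z₄) = 1` through weights `ω(𝐫, 𝐬, s₀)` (the six-item
  Definition 5.1) and states `N(D, B) = Σ ω(𝐫, 𝐬, s₀) #𝒩(B; 𝐫, 𝐬, s₀)` (Lemma 5.2, (5.2)). With `ω` as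
  printed this is false: a direct check of the `2⁸` local divisibility patterns shows that the
  inner sum `Σ_{𝐫 ∣ (p,𝐲), 𝐬 ∣ (p,𝐱), s₀ ∣ (p,𝐱)} ω(𝐫, 𝐬, s₀)` of its proof equals `−1` instead of `0`
  exactly when `p ∣ xᵢ` for all `i` and `p` divides some but not all `yᵢ` (the step
  "`μ(p)(ω(𝟏,𝟏,1) + ω((p,p,p,p),𝟏,1)) = −(1 − 1) = 0`" uses the term `𝐫 = (p,p,p,p)`, which is in
  the sum only when `p ∣ yᵢ` for every `i`); such `𝐳` occur, e.g. `𝐳 = 4·(8, 1, 16, −25)` with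
  `p = 2` (`𝐱 = (2, 2, 8, 10)`, `𝐲 = (2, 1, 1, −1)`). The plain Möbius form proved here is what the
  rest of §5 actually needs (a representation of `1_{gcd(𝐳)=1}` by conditions `sᵢ ∣ xᵢ` with
  `|weights| ≤ 1`); it changes the bookkeeping of the constant in (5.10), not the exponents.
  (A first erratum, on the proof of Prop. 3.2, is recorded in the module docstring of
  `ShuteFourSquareful.lean` and in `ShuteFourSquarefulHolder.lean`.)
* **The last paragraph of §5.** From Prop. 3.1 (through (5.1),
  `Shute2021_prop31.mainCount_le`) and the truncated asymptotic
  `|N(D, B) − cB| ≤ C_ε (B^{1+ε}D^{-1/4} + B^{41/42+ε}D^{11/8})` for `1 ≤ D ≤ B^{1/16}` — which is what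
  Theorem 4.2 (= Thm. 1.3) at `𝐚 = 𝐬²𝐲³`, summed with Lemmas 5.2–5.4 and 4.15, provides — the choice
  `D = ⌊B^{4/245}⌋` gives `N(B) = cB + O_ε(B^{734/735+ε})`
  (`Shute2021.mainCount_sub_linear_le_of_truncated`; `4/(245·12) = 1/735`,
  `41/42 + (4/245)(11/8) = 734/735`), and with `c > 0` this is `Shute2021_theorem11`
  (`Shute2021.theorem11_of_truncated`).
* **Where Theorem 1.3 enters** ((1.6), (5.5)–(5.7)). Fibring the `d`-th term of the corrected
  Lemma 5.2 over the admissible `𝐲` (`Shute2021.yVectors`, `Shute2021.fibreCount` = the paper's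
  `N_𝐲(B; 𝐬, s₀)` with `s₀` folded into `𝐬`, `Shute2021.card_params_dvd_eq_sum_fibreCount`) and
  substituting `xᵢ ↦ sᵢxᵢ` (`Shute2021.fibreCount_eq_posQuadCount`) expresses `N(D, B)` as a
  Möbius-weighted sum of the counts `N⁺_𝐚(B) = #{𝐱 ∈ ℕ⁴ : Σ aᵢxᵢ² = 0, |aᵢ|xᵢ² ≤ B}`
  (`Shute2021.posQuadCount`; the paper's `N_𝐚(B)` of (1.6) is `16 N⁺_𝐚(B)`) at `𝐚 = 𝐬(d, 𝐲)²𝐲³`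
  (`Shute2021.mainCountTrunc_eq_sum_moebius_posQuadCount`) — the quantity Theorem 1.3 / 4.2
  evaluates.

## What is still missing for `Shute2021_theorem11`

Exactly the circle-method input and the positivity of the constant, i.e. the hypothesis `hmain` of
`Shute2021.theorem11_of_truncated` starting from `Shute2021.mainCountTrunc_eq_sum_moebius_posQuadCount`:
Theorem 4.2 / 1.3 (Heath-Brown's
`δ`-method asymptotic for `N_𝐚(B)` with the singular series `𝔊_𝐚`, singular integral `σ_∞(𝛆)` and
the explicit dependence on `𝐚`, §4, resting on [D. R. Heath-Brown, J. reine angew. Math. 481 (1996)]),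
Lemma 4.15 (`𝔊_𝐚 ≪ |A|^ε Δ^{1/4}`), Lemmas 5.3–5.4 (the sums `E₁(D) ≪ D^{-1/4+ε}`,
`E₂(D) ≪ D^{11/8+ε}`), Lemma 5.5 with `c > 0` ((5.10)), and Prop. 3.1 itself (named fact
`Shute2021_prop31`, reduced to `Shute2021_prop32` in `ShuteFourSquarefulProofs.lean`).

## References

* A. Shute, *Sums of four squareful numbers*, arXiv:2104.06966v1 [math.NT] (2021) (numbering of
  v1): §1, (1.5) (the fibre sum `N(B) = (1/16) Σ_𝐲 N_𝐲(B)`), the sentence before it and the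
  display after it (`N_𝐲(B)`), (1.6) (`N_𝐚(B)`); §5: notation, (5.1), Definition 5.1 (`ω`) and
  Lemma 5.2 ((5.2)–(5.4)) with its proof, (5.5) (fibring `#𝒩(B; 𝐫, 𝐬, s₀)` over `𝐲`), (5.6)
  (`N_𝐲(B; 𝐬, s₀)`) and the display after it (substitution `xᵢ ↦ s₀sᵢxᵢ`), (5.7), Lemmas 5.3–5.4
  (shape of the error terms), (5.10) and Lemma 5.5 (the constant), and the last paragraph before
  §5.1 (choice `D = B^{4/245}`). [Shute2021]
-/

noncomputable section

open Finset

namespace Literature.NumberTheory.DiophantineGeometry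

namespace Shute2021


/-! ### The parameter side `(𝐱, 𝐲)` of the squareful vectors `𝐳` -/

/-- The parameter box of §5: pairs `(𝐱, 𝐲) ∈ ℤ⁴ × ℤ⁴` with `|xᵢ|, |yᵢ| ≤ B` (the parameters of a
squareful `zᵢ = yᵢ³xᵢ²` with `|zᵢ| ≤ B` satisfy `|xᵢ|, |yᵢ| ≤ |zᵢ| ≤ B`). [folklore] -/
def paramBox (B : ℕ) : Finset ((Fin 4 → ℤ) × (Fin 4 → ℤ)) :=
  box (fun _ => B) ×ˢ box (fun _ => B)

/-- `(𝐱, 𝐲)` are the parameters of a vector of nonzero squareful integers of size `≤ B`: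
`xᵢ ≥ 1`, `yᵢ ≠ 0` square-free and `|yᵢ³ xᵢ²| ≤ B` ("Let `z₁, …, z₄` denote nonzero squareful
numbers, and `x₁, …, x₄ ∈ ℕ`, `y₁, …, y₄ ∈ ℤ_{≠0}` the unique integers such that `zᵢ = xᵢ²yᵢ³` and
`yᵢ` is square-free"). [cite: Shute2021, §5 (notation)] -/
def IsParams (B : ℕ) (p : (Fin 4 → ℤ) × (Fin 4 → ℤ)) : Prop :=
  ∀ i, 0 < p.1 i ∧ p.2 i ≠ 0 ∧ Squarefree (p.2 i).natAbs ∧ |p.2 i ^ 3 * p.1 i ^ 2| ≤ (B : ℤ)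

/-- The squareful vector `𝐳 = (yᵢ³ xᵢ²)ᵢ` with parameters `(𝐱, 𝐲)`. [cite: Shute2021, §1, §5] -/
def toZ (p : (Fin 4 → ℤ) × (Fin 4 → ℤ)) : Fin 4 → ℤ := fun i => p.2 i ^ 3 * p.1 i ^ 2

/-- Coordinates of `toZ`. [folklore] -/
@[simp] theorem toZ_apply (p : (Fin 4 → ℤ) × (Fin 4 → ℤ)) (i : Fin 4) :
    toZ p i = p.2 i ^ 3 * p.1 i ^ 2 := rfl

/-- Membership in the parameter box: `|xᵢ| ≤ B` and `|yᵢ| ≤ B`. [folklore] -/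
theorem mem_paramBox {B : ℕ} {p : (Fin 4 → ℤ) × (Fin 4 → ℤ)} :
    p ∈ paramBox B ↔ (∀ i, |p.1 i| ≤ B) ∧ ∀ i, |p.2 i| ≤ B := by
  simp [paramBox, mem_box]

/-- The parameters of `toZ p` are `p` itself (uniqueness of the decomposition). [cite: Shute2021, §1] -/
theorem squarefulParams_toZ {B : ℕ} {p : (Fin 4 → ℤ) × (Fin 4 → ℤ)} (hp : IsParams B p) (i : Fin 4) :
    squarefulParams (toZ p i) = (p.1 i, p.2 i) :=
  squarefulParams_pow_three_mul_sq (hp i).1 (hp i).2.1 (hp i).2.2.1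

/-- **Transfer `𝐳 ↔ (𝐱, 𝐲)`**: for any property `Q` of vectors, the vectors `𝐳` of nonzero squareful
integers with `|zᵢ| ≤ B` satisfying `Q` are equinumerous with the parameters `(𝐱, 𝐲)`
(`xᵢ ≥ 1`, `yᵢ ≠ 0` square-free, `|yᵢ³xᵢ²| ≤ B`) whose vector `(yᵢ³xᵢ²)ᵢ` satisfies `Q` — the map
`𝐳 ↦ (𝐱, 𝐲)` is a bijection by existence and uniqueness of the decomposition `z = y³x²`.
[cite: Shute2021, §1 ("Every nonzero squareful integer z can be written uniquely in the form
z = y³x²"), (1.5)] -/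
theorem card_filter_squareful_eq_card_params (B : ℕ) (Q : (Fin 4 → ℤ) → Prop)
    [DecidablePred Q] [DecidablePred (IsParams B)] [DecidablePred fun z : Fin 4 → ℤ => ∀ i, IsSquareful (z i)] :
    #{z ∈ box (fun _ => B) | (∀ i, IsSquareful (z i)) ∧ Q z} =
      #{p ∈ paramBox B | IsParams B p ∧ Q (toZ p)} := by
  symm
  refine Finset.card_bij (fun p _ => toZ p) ?_ ?_ ?_
  · intro p hp
    rw [mem_filter] at hp ⊢
    obtain ⟨-, hP, hQ⟩ := hp
    refine ⟨mem_box.2 fun i => (hP i).2.2.2, fun i => ?_, hQ⟩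
    exact isSquareful_pow_three_mul_sq (hP i).1.ne' (hP i).2.1
  · intro p hp p' hp' h
    rw [mem_filter] at hp hp'
    have hi : ∀ i, p.1 i = p'.1 i ∧ p.2 i = p'.2 i := fun i =>
      (pow_three_mul_sq_eq_iff (hp.2.1 i).1 (hp'.2.1 i).1 (hp.2.1 i).2.2.1 (hp'.2.1 i).2.2.1).1
        (congrFun h i)
    exact Prod.ext (funext fun i => (hi i).1) (funext fun i => (hi i).2)
  · intro z hz
    rw [mem_filter, mem_box] at hz
    obtain ⟨hbox, hsqf, hQ⟩ := hz
    have hspec := fun i => squarefulParams_spec (hsqf i)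
    have hz : toZ (fun i => (squarefulParams (z i)).1, fun i => (squarefulParams (z i)).2) = z :=
      funext fun i => (hspec i).2.2.2.symm
    refine ⟨(fun i => (squarefulParams (z i)).1, fun i => (squarefulParams (z i)).2), ?_, hz⟩
    rw [mem_filter, mem_paramBox]
    refine ⟨⟨fun i => (squarefulParams_abs_le (hsqf i)).1.trans (hbox i),
      fun i => (squarefulParams_abs_le (hsqf i)).2.trans (hbox i)⟩, fun i => ⟨(hspec i).1,
      (hspec i).2.1, (hspec i).2.2.1, ?_⟩, by rwa [hz]⟩
    calc |(squarefulParams (z i)).2 ^ 3 * (squarefulParams (z i)).1 ^ 2| = |z i| := by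
          rw [← (hspec i).2.2.2]
      _ ≤ B := hbox i


/-- In `ℤ`, `a · b²` with `b ≠ 0` is a square iff `a` is. [folklore] -/
theorem isSquare_mul_sq_iff {a b : ℤ} (hb : b ≠ 0) : IsSquare (a * b ^ 2) ↔ IsSquare a := by
  refine ⟨fun h => ?_, fun ⟨r, hr⟩ => ⟨r * b, by rw [hr]; ring⟩⟩
  rw [← Rat.isSquare_intCast_iff] at h ⊢
  obtain ⟨r, hr⟩ := h
  have hb' : (b : ℚ) ≠ 0 := by exact_mod_cast hb
  refine ⟨r / b, ?_⟩
  field_simp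
  push_cast at hr
  linear_combination hr

/-- **`z₁z₂z₃z₄ = □ ⟺ y₁y₂y₃y₄ = □`** for `zᵢ = yᵢ³xᵢ²` with `xᵢ, yᵢ ≠ 0`
(`∏ yᵢ³xᵢ² = (∏ yᵢ) · (∏ xᵢyᵢ)²`). [cite: Shute2021, §1 ("The condition z₁⋯z₄ = □ from (1.2) is
equivalent to the condition y₁⋯y₄ = □")] -/
theorem isSquare_prod_toZ_iff {p : (Fin 4 → ℤ) × (Fin 4 → ℤ)} (hx : ∀ i, p.1 i ≠ 0)
    (hy : ∀ i, p.2 i ≠ 0) : IsSquare (∏ i, toZ p i) ↔ IsSquare (∏ i, p.2 i) := by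
  have h : ∏ i, toZ p i = (∏ i, p.2 i) * (∏ i, p.1 i * p.2 i) ^ 2 := by
    simp only [toZ_apply, Fin.prod_univ_four]; ring
  rw [h, isSquare_mul_sq_iff]
  exact Finset.prod_ne_zero_iff.2 fun i _ => mul_ne_zero (hx i) (hy i)

/-! ### Primitivity -/

/-- The `gcd` of the absolute values of the coordinates of `𝐳 ∈ ℤ⁴`. [folklore] -/
def gcd4 (z : Fin 4 → ℤ) : ℕ := Finset.univ.gcd fun i => (z i).natAbs

/-- `d` divides every coordinate of `𝐳` iff `d ∣ gcd(|z₁|, …, |z₄|)`. [folklore] -/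
theorem natCast_dvd_iff_dvd_gcd4 {z : Fin 4 → ℤ} {d : ℕ} : (∀ i, (d : ℤ) ∣ z i) ↔ d ∣ gcd4 z := by
  rw [gcd4, Finset.dvd_gcd_iff]
  simp [Int.natCast_dvd]

/-- `𝐳` is primitive iff `gcd(|z₁|, …, |z₄|) = 1`. [folklore] -/
theorem isPrimitive_iff_gcd4 {z : Fin 4 → ℤ} : IsPrimitive z ↔ gcd4 z = 1 := by
  constructor
  · intro h
    exact h _ (natCast_dvd_iff_dvd_gcd4.2 dvd_rfl)
  · intro h d hd
    exact Nat.dvd_one.1 (h ▸ natCast_dvd_iff_dvd_gcd4.1 hd)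

/-- The `gcd` of a vector with a nonzero coordinate is positive. [folklore] -/
theorem gcd4_pos {z : Fin 4 → ℤ} (hz : z 0 ≠ 0) : 0 < gcd4 z := by
  refine Nat.pos_of_ne_zero fun h => hz ?_
  have : (0 : ℤ) ∣ z 0 := by
    have := (natCast_dvd_iff_dvd_gcd4 (z := z) (d := 0)).2 (h ▸ dvd_rfl) 0
    simpa using this
  exact zero_dvd_iff.1 this

/-- The `gcd` of a vector is at most the size of any nonzero coordinate. [folklore] -/
theorem gcd4_le {z : Fin 4 → ℤ} (hz : z 0 ≠ 0) : (gcd4 z : ℤ) ≤ |z 0| := by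
  have h : (gcd4 z : ℤ) ∣ z 0 := (natCast_dvd_iff_dvd_gcd4 (d := gcd4 z)).2 dvd_rfl 0
  exact Int.le_of_dvd (abs_pos.2 hz) ((dvd_abs _ _).2 h)

/-- `𝐳` is primitive iff no prime divides every coordinate. [folklore] -/
theorem isPrimitive_iff_forall_prime {z : Fin 4 → ℤ} :
    IsPrimitive z ↔ ∀ p : ℕ, p.Prime → ∃ i, ¬ (p : ℤ) ∣ z i := by
  constructor
  · intro h p hp
    by_contra hall
    push Not at hall
    exact hp.ne_one (h p hall)
  · intro h d hd
    by_contra hd1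
    obtain ⟨p, hp, hpd⟩ := Nat.exists_prime_and_dvd hd1
    obtain ⟨i, hi⟩ := h p hp
    exact hi ((Int.natCast_dvd_natCast.2 hpd).trans (hd i))

/-- For a prime `p` and `x, y`: `p ∣ y³x² ⟺ p ∣ x·y`. [folklore] -/
theorem prime_dvd_pow_three_mul_sq_iff {p : ℕ} (hp : p.Prime) (x y : ℤ) :
    (p : ℤ) ∣ y ^ 3 * x ^ 2 ↔ (p : ℤ) ∣ x * y := by
  have hp' : Prime (p : ℤ) := Nat.prime_iff_prime_int.1 hp
  rw [hp'.dvd_mul, hp'.dvd_mul, hp'.dvd_pow_iff_dvd (by norm_num), hp'.dvd_pow_iff_dvd (by norm_num),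
    or_comm]

/-- **`gcd(z₁, …, z₄) = 1 ⟺ gcd(x₁y₁, …, x₄y₄) = 1`** for `zᵢ = yᵢ³xᵢ²` (the coprimality condition
of `N_𝐲(B)` in (1.5)). [cite: Shute2021, §1, display after (1.5) (definition of N_y(B))] -/
theorem isPrimitive_toZ_iff (p : (Fin 4 → ℤ) × (Fin 4 → ℤ)) :
    IsPrimitive (toZ p) ↔ IsPrimitive fun i => p.1 i * p.2 i := by
  simp only [isPrimitive_iff_forall_prime, toZ]
  refine forall₂_congr fun q hq => exists_congr fun i => ?_
  rw [prime_dvd_pow_three_mul_sq_iff hq]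

/-! ### `N(B)` and `N(D, B)` on the parameter side -/

open Classical in
/-- **`N(B)` through the parameters** (eq. (1.5) without the sign bookkeeping): `N(B)` is the number
of `(𝐱, 𝐲)` with `xᵢ ≥ 1`, `yᵢ ≠ 0` square-free, `|yᵢ³xᵢ²| ≤ B`, `Σ yᵢ³xᵢ² = 0`,
`gcd(x₁y₁, …, x₄y₄) = 1` and `y₁y₂y₃y₄ ≠ □`. (The paper lets `xᵢ` range over `ℤ_{≠0}` and divides
by `16`.) [cite: Shute2021, §1, (1.5)] -/
theorem mainCount_eq_card_params (B : ℕ) :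
    mainCount B = #{p ∈ paramBox B | IsParams B p ∧ (IsPrimitive fun i => p.1 i * p.2 i) ∧
      ∑ i, p.2 i ^ 3 * p.1 i ^ 2 = 0 ∧ ¬ IsSquare (∏ i, p.2 i)} := by
  unfold mainCount
  rw [card_filter_squareful_eq_card_params B
    (fun z => IsPrimitive z ∧ ∑ i, z i = 0 ∧ ¬ IsSquare (∏ i, z i))]
  refine Finset.card_equiv (Equiv.refl _) fun p => ?_
  simp only [Equiv.refl_apply, mem_filter, and_congr_right_iff]
  intro _ hP
  rw [isPrimitive_toZ_iff, isSquare_prod_toZ_iff (fun i => (hP i).1.ne') (fun i => (hP i).2.1)]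
  simp [toZ]

open Classical in
/-- **`N(D, B)` through the parameters**: as `mainCount_eq_card_params` with the extra condition
`|y₁y₂y₃y₄| ≤ D`. [cite: Shute2021, §5, (5.1) (definition of N(D,B))] -/
theorem mainCountTrunc_eq_card_params (B D : ℕ) :
    mainCountTrunc B D = #{p ∈ paramBox B | IsParams B p ∧ (IsPrimitive fun i => p.1 i * p.2 i) ∧
      ∑ i, p.2 i ^ 3 * p.1 i ^ 2 = 0 ∧ ¬ IsSquare (∏ i, p.2 i) ∧ |∏ i, p.2 i| ≤ (D : ℤ)} := by
  unfold mainCountTrunc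
  have h1 : #{z ∈ box (fun _ => B) |
      ((∀ i, IsSquareful (z i)) ∧ IsPrimitive z ∧ ∑ i, z i = 0 ∧ ¬ IsSquare (∏ i, z i)) ∧
        |∏ i, (squarefulParams (z i)).2| ≤ (D : ℤ)} =
      #{z ∈ box (fun _ => B) | (∀ i, IsSquareful (z i)) ∧
        ((IsPrimitive z ∧ ∑ i, z i = 0 ∧ ¬ IsSquare (∏ i, z i)) ∧
          |∏ i, (squarefulParams (z i)).2| ≤ (D : ℤ))} := by
    congr 1
    exact Finset.filter_congr fun z _ => and_assoc
  rw [h1, card_filter_squareful_eq_card_params B (fun z => (IsPrimitive z ∧ ∑ i, z i = 0 ∧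
    ¬ IsSquare (∏ i, z i)) ∧ |∏ i, (squarefulParams (z i)).2| ≤ (D : ℤ))]
  refine Finset.card_equiv (Equiv.refl _) fun p => ?_
  simp only [Equiv.refl_apply, mem_filter, and_congr_right_iff]
  intro _ hP
  rw [isPrimitive_toZ_iff, isSquare_prod_toZ_iff (fun i => (hP i).1.ne') (fun i => (hP i).2.1)]
  have h2 : ∀ i, squarefulParams (p.2 i ^ 3 * p.1 i ^ 2) = (p.1 i, p.2 i) := fun i =>
    squarefulParams_pow_three_mul_sq (hP i).1 (hP i).2.1 (hP i).2.2.1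
  simp only [toZ, h2, and_assoc]

/-! ### Reinsertion of the coprimality condition (Lemma 5.2, corrected form) -/

open scoped ArithmeticFunction.Moebius

/-- For square-free `d`: `d ∣ y³x² ⟺ (d / gcd(d, |y|)) ∣ x` — the change of
variables `xᵢ ↦ sᵢ xᵢ` with `sᵢ = d / gcd(d, |yᵢ|)` behind the passage from `N_𝐲(B; 𝐬, s₀)` to
`N_{𝐬²𝐲³}(B/s₀²)`. [cite: Shute2021, §5 (display after (5.6))] -/
theorem natCast_dvd_pow_three_mul_sq_iff {d : ℕ} (hd : Squarefree d) (x y : ℤ) :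
    (d : ℤ) ∣ y ^ 3 * x ^ 2 ↔ ((d / Nat.gcd d y.natAbs : ℕ) : ℤ) ∣ x := by
  set g := Nat.gcd d y.natAbs with hg
  set e := d / g with he
  have hgd : g ∣ d := Nat.gcd_dvd_left _ _
  have hde : d = g * e := (Nat.mul_div_cancel' hgd).symm
  have hsq : Nat.Coprime g e ∧ Squarefree g ∧ Squarefree e := Nat.squarefree_mul_iff.1 (hde ▸ hd)
  -- `e` is coprime to `y`
  have hey : Nat.Coprime e y.natAbs := by
    have h1 : Nat.gcd e y.natAbs ∣ g :=
      Nat.dvd_gcd ((Nat.gcd_dvd_left _ _).trans (Dvd.intro_left g hde.symm)) (Nat.gcd_dvd_right _ _)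
    have h2 : Nat.gcd e y.natAbs ∣ e := Nat.gcd_dvd_left _ _
    have h3 : Nat.gcd e y.natAbs ∣ Nat.gcd g e := Nat.dvd_gcd h1 h2
    rw [Nat.Coprime.gcd_eq_one hsq.1, Nat.dvd_one] at h3
    exact h3
  constructor
  · intro h
    have h1 : (e : ℤ) ∣ y ^ 3 * x ^ 2 := (Int.natCast_dvd_natCast.2 ⟨g, by rw [hde, mul_comm]⟩).trans h
    have h2 : (e : ℤ) ∣ x ^ 2 := by
      refine Int.dvd_of_dvd_mul_right_of_gcd_one h1 ?_
      rw [Int.gcd_eq_natAbs, Int.natAbs_natCast, Int.natAbs_pow]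
      exact Nat.Coprime.pow_right 3 hey
    exact (Squarefree.dvd_pow_iff_dvd (Int.squarefree_natCast.2 hsq.2.2) two_ne_zero).1 h2
  · intro h
    have h1 : (g : ℤ) ∣ y ^ 3 := by
      have : (g : ℤ) ∣ y := Int.natCast_dvd.2 (Nat.gcd_dvd_right _ _)
      exact this.trans (dvd_pow_self y three_ne_zero)
    have h2 : (e : ℤ) ∣ x ^ 2 := h.trans (dvd_pow_self x two_ne_zero)
    rw [hde, Nat.cast_mul]
    exact mul_dvd_mul h1 h2

/-- The coordinates `yᵢ³xᵢ²` of the vector of a parameter pair are nonzero. [folklore] -/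
theorem toZ_ne_zero {B : ℕ} {p : (Fin 4 → ℤ) × (Fin 4 → ℤ)} (hp : IsParams B p) (i : Fin 4) :
    toZ p i ≠ 0 :=
  mul_ne_zero (pow_ne_zero 3 (hp i).2.1) (pow_ne_zero 2 (hp i).1.ne')

open Classical in
/-- **Lemma 5.2 of Shute (2021), corrected form (Möbius inversion of the coprimality condition).**
`N(D, B) = Σ_{d=1}^{B} μ(d) · #{(𝐱, 𝐲) : xᵢ ≥ 1, yᵢ ≠ 0 square-free, |yᵢ³xᵢ²| ≤ B, d ∣ yᵢ³xᵢ² ∀ i,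
Σ yᵢ³xᵢ² = 0, y₁y₂y₃y₄ ≠ □, |y₁y₂y₃y₄| ≤ D}`.

The paper inserts the condition `gcd(z₁, …, z₄) = 1` through weights `ω(𝐫, 𝐬, s₀)` (Definition
5.1) and claims `N(D, B) = Σ ω(𝐫, 𝐬, s₀) #𝒩(B; 𝐫, 𝐬, s₀)` (Lemma 5.2, (5.2)). *Erratum*: with
`ω` as printed the inner sum `Σ_{𝐫 ∣ (p, 𝐲), 𝐬 ∣ (p, 𝐱), s₀ ∣ (p, 𝐱)} ω(𝐫, 𝐬, s₀)` equals `−1`, not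
`0`, whenever `p ∣ xᵢ` for all `i` and `p` divides some but not all `yᵢ` (the proof's step
"`μ(p)(ω(𝟏, 𝟏, 1) + ω((p,p,p,p), 𝟏, 1)) = 0`" uses the second term, which is only present when
`p ∣ yᵢ` for every `i`); e.g. `𝐳 = 4 · (8, 1, 16, −25)`, `p = 2`. We therefore formalize
Lemma 5.2 in the plain Möbius form `1_{gcd(𝐳) = 1} = Σ_{d ∣ gcd(𝐳)} μ(d)`; for square-free `d`
the condition `d ∣ yᵢ³xᵢ²` is `(d / gcd(d, |yᵢ|)) ∣ xᵢ` (`natCast_dvd_pow_three_mul_sq_iff`), which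
is the substitution `xᵢ ↦ sᵢxᵢ` the paper performs next.
[cite: Shute2021, §5, Definition 5.1 and Lemma 5.2] -/
theorem mainCountTrunc_eq_sum_moebius (B D : ℕ) :
    (mainCountTrunc B D : ℤ) = ∑ d ∈ Icc 1 B, (μ d : ℤ) *
      #{p ∈ paramBox B | IsParams B p ∧ (∀ i, (d : ℤ) ∣ p.2 i ^ 3 * p.1 i ^ 2) ∧
        ∑ i, p.2 i ^ 3 * p.1 i ^ 2 = 0 ∧ ¬ IsSquare (∏ i, p.2 i) ∧ |∏ i, p.2 i| ≤ (D : ℤ)} := by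
  -- the conditions other than primitivity / divisibility
  set R : (Fin 4 → ℤ) × (Fin 4 → ℤ) → Prop := fun p =>
    ∑ i, p.2 i ^ 3 * p.1 i ^ 2 = 0 ∧ ¬ IsSquare (∏ i, p.2 i) ∧ |∏ i, p.2 i| ≤ (D : ℤ) with hR
  set F : Finset ((Fin 4 → ℤ) × (Fin 4 → ℤ)) := {p ∈ paramBox B | IsParams B p ∧ R p} with hF
  -- Step 1: `N(D, B) = #{p ∈ F : gcd(toZ p) = 1}`
  have h1 : mainCountTrunc B D = #{p ∈ F | gcd4 (toZ p) = 1} := by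
    rw [mainCountTrunc_eq_card_params, hF, Finset.filter_filter]
    refine congrArg Finset.card (Finset.filter_congr fun p _ => ?_)
    rw [← isPrimitive_iff_gcd4, isPrimitive_toZ_iff, hR]
    tauto
  -- Step 2: Möbius inversion
  have h2 := Literature.Algebra.EuclideanLattices.card_filter_eq_one_eq_sum_moebius F
    (fun p => gcd4 (toZ p)) B ?_ ?_
  rotate_left
  · intro p hp
    rw [hF, mem_filter] at hp
    exact gcd4_pos (toZ_ne_zero hp.2.1 0)
  · intro p hp
    rw [hF, mem_filter] at hp
    have := (gcd4_le (toZ_ne_zero hp.2.1 0)).trans (hp.2.1 0).2.2.2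
    exact_mod_cast this
  rw [h1, h2]
  -- Step 3: identify the summands
  refine Finset.sum_congr rfl fun d _ => ?_
  congr 2
  rw [hF, Finset.filter_filter]
  refine congrArg Finset.card (Finset.filter_congr fun p _ => ?_)
  rw [← natCast_dvd_iff_dvd_gcd4, hR]
  simp only [toZ_apply]
  tauto

open Classical in
/-- **Lemma 5.2, corrected form, after the substitution**: only square-free `d` contribute, and for
them `d ∣ yᵢ³xᵢ²` reads `sᵢ ∣ xᵢ` with `sᵢ = d / gcd(d, |yᵢ|)`.
[cite: Shute2021, §5, Lemma 5.2 and the display after (5.6)] -/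
theorem mainCountTrunc_eq_sum_moebius_squarefree (B D : ℕ) :
    (mainCountTrunc B D : ℤ) = ∑ d ∈ (Icc 1 B).filter Squarefree, (μ d : ℤ) *
      #{p ∈ paramBox B | IsParams B p ∧ (∀ i, ((d / Nat.gcd d (p.2 i).natAbs : ℕ) : ℤ) ∣ p.1 i) ∧
        ∑ i, p.2 i ^ 3 * p.1 i ^ 2 = 0 ∧ ¬ IsSquare (∏ i, p.2 i) ∧ |∏ i, p.2 i| ≤ (D : ℤ)} := by
  rw [mainCountTrunc_eq_sum_moebius, Finset.sum_filter]
  refine Finset.sum_congr rfl fun d _ => ?_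
  by_cases hd : Squarefree d
  · rw [if_pos hd]
    congr 2
    refine congrArg Finset.card (Finset.filter_congr fun p _ => ?_)
    refine and_congr_right fun _ => and_congr_left fun _ => forall_congr' fun i => ?_
    exact natCast_dvd_pow_three_mul_sq_iff hd _ _
  · rw [if_neg hd, ArithmeticFunction.moebius_eq_zero_of_not_squarefree hd]
    simp

/-! ### The last step of §5: the choice `D = B^{4/245}` -/

/-- For `t ≥ 1`, `D = ⌊t⌋` satisfies `1 ≤ D`, `D ≤ t` and `t/2 ≤ D`. [folklore] -/
theorem one_le_floor_and {t : ℝ} (ht : 1 ≤ t) :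
    1 ≤ ⌊t⌋₊ ∧ (⌊t⌋₊ : ℝ) ≤ t ∧ t / 2 ≤ (⌊t⌋₊ : ℝ) := by
  have h1 : 1 ≤ ⌊t⌋₊ := Nat.le_floor (by exact_mod_cast ht)
  have h2 : (⌊t⌋₊ : ℝ) ≤ t := Nat.floor_le (by linarith)
  have h3 : t < (⌊t⌋₊ : ℝ) + 1 := Nat.lt_floor_add_one t
  have h4 : (1 : ℝ) ≤ (⌊t⌋₊ : ℝ) := by exact_mod_cast h1
  exact ⟨h1, h2, by linarith⟩

/-- For `t ≥ 1` and `s ≥ 0`: `⌊t⌋^{-s} ≤ 2^s t^{-s}`. [folklore] -/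
theorem floor_rpow_neg_le {t s : ℝ} (ht : 1 ≤ t) (hs : 0 ≤ s) :
    ((⌊t⌋₊ : ℕ) : ℝ) ^ (-s) ≤ (2 : ℝ) ^ s * t ^ (-s) := by
  obtain ⟨-, -, h3⟩ := one_le_floor_and ht
  have ht2 : 0 < t / 2 := by linarith
  calc ((⌊t⌋₊ : ℕ) : ℝ) ^ (-s) ≤ (t / 2) ^ (-s) :=
        Real.rpow_le_rpow_of_nonpos ht2 h3 (by linarith)
    _ = (2 : ℝ) ^ s * t ^ (-s) := by
        rw [Real.div_rpow (by linarith) (by norm_num), Real.rpow_neg (by norm_num : (0:ℝ) ≤ 2),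
          div_inv_eq_mul, mul_comm]

/-- For `t ≥ 1` and `s ≥ 0`: `⌊t⌋^{s} ≤ t^{s}`. [folklore] -/
theorem floor_rpow_le {t s : ℝ} (ht : 1 ≤ t) (hs : 0 ≤ s) :
    ((⌊t⌋₊ : ℕ) : ℝ) ^ s ≤ t ^ s := by
  obtain ⟨-, h2, -⟩ := one_le_floor_and ht
  exact Real.rpow_le_rpow (by positivity) h2 hs

/-- **The last paragraph of §5: Theorem 1.1 from (5.1) and the truncated asymptotic.** Suppose
Prop. 3.1 (hence (5.1): `N(D, B) ≤ N(B) ≤ N(D, B) + C_ε B^{1+ε}D^{-1/12}`,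
`Shute2021_prop31.mainCount_le`) and, for some real `c`, the estimate that Theorem 4.2 and
Lemmas 5.2–5.4 furnish for the truncated count:
`|N(D, B) − cB| ≤ C_ε (B^{1+ε} D^{-1/4} + B^{41/42+ε} D^{11/8})` for `1 ≤ D ≤ B^{1/16}` (main term
completed to all `𝐲` at the cost `B · E₁(D)`, `E₁(D) ≪ D^{-1/4+ε}`, Lemma 5.3; error terms summed to
`B^{41/42+ε} E₂(D)`, `E₂(D) ≪ D^{11/8+ε}`, Lemma 5.4; `D^ε ≤ B^ε`). Then for every `ε > 0`,
`N(B) = cB + O_ε(B^{734/735+ε})`: take `D = ⌊B^{4/245}⌋`, so that `B^{1+ε}D^{-1/12} ≍ B^{1−1/735+ε}`,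
`B^{41/42+ε}D^{11/8} ≤ B^{41/42+11/490+ε} = B^{734/735+ε}` and `B^{1+ε}D^{-1/4} ≪ B^{244/245+ε}`.
[cite: Shute2021, §5, last paragraph before §5.1 ("Making the choice D = B^{4/245}, we obtain
N(B) = cB + O(B^{734/735+ε})")] -/
theorem mainCount_sub_linear_le_of_truncated (h31 : Shute2021_prop31) {c : ℝ}
    (hmain : ∀ ε : ℝ, 0 < ε → ∃ C : ℝ, ∀ B D : ℕ, 1 ≤ B → 1 ≤ D →
      (D : ℝ) ≤ (B : ℝ) ^ (1 / 16 : ℝ) →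
        |(mainCountTrunc B D : ℝ) - c * B| ≤
          C * ((B : ℝ) ^ (1 + ε) * (D : ℝ) ^ (-(1 / 4 : ℝ)) +
            (B : ℝ) ^ (41 / 42 + ε : ℝ) * (D : ℝ) ^ (11 / 8 : ℝ))) :
    ∀ ε : ℝ, 0 < ε → ∃ C : ℝ, ∀ B : ℕ, 1 ≤ B →
      |(mainCount B : ℝ) - c * B| ≤ C * (B : ℝ) ^ (734 / 735 + ε : ℝ) := by
  intro ε hε
  obtain ⟨C₁, hC₁, h51⟩ := Shute2021_prop31.mainCount_le h31 ε hε
  obtain ⟨C₂, h2⟩ := hmain ε hε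
  -- a nonnegative version of `C₂`
  set C₂' := max C₂ 0 with hC₂'
  refine ⟨C₂' * ((2 : ℝ) ^ (1 / 4 : ℝ) + 1) + C₁ * (2 : ℝ) ^ (1 / 12 : ℝ), fun B hB => ?_⟩
  have hB1 : (1 : ℝ) ≤ B := by exact_mod_cast hB
  have hB0 : (0 : ℝ) < B := by linarith
  -- the choice of `D`
  set t : ℝ := (B : ℝ) ^ (4 / 245 : ℝ) with ht
  have ht1 : 1 ≤ t := Real.one_le_rpow hB1 (by norm_num)
  set D : ℕ := ⌊t⌋₊ with hD
  obtain ⟨hD1, hDt, htD⟩ := one_le_floor_and ht1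
  have hD0 : (0 : ℝ) < D := by exact_mod_cast hD1
  have hDB : (D : ℝ) ≤ (B : ℝ) ^ (1 / 16 : ℝ) :=
    hDt.trans (Real.rpow_le_rpow_of_exponent_le hB1 (by norm_num))
  -- (5.1): `N(D, B) ≤ N(B) ≤ N(D, B) + C₁ B^{1+ε} D^{-1/12}`
  have hlow : (mainCountTrunc B D : ℝ) ≤ mainCount B := by exact_mod_cast mainCountTrunc_le B D
  have hupp := h51 B D hB hD1
  -- the truncated asymptotic at this `D`
  have hmid := h2 B D hB hD1 hDB
  -- sizes of the powers of `D`
  have e1 : (D : ℝ) ^ (-(1 / 12 : ℝ)) ≤ (2 : ℝ) ^ (1 / 12 : ℝ) * (B : ℝ) ^ (-(1 / 735 : ℝ)) := by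
    have := floor_rpow_neg_le ht1 (by norm_num : (0 : ℝ) ≤ 1 / 12)
    rw [← hD] at this
    refine this.trans (le_of_eq ?_)
    rw [ht, ← Real.rpow_mul hB0.le]
    norm_num
  have e2 : (D : ℝ) ^ (-(1 / 4 : ℝ)) ≤ (2 : ℝ) ^ (1 / 4 : ℝ) * (B : ℝ) ^ (-(1 / 245 : ℝ)) := by
    have := floor_rpow_neg_le ht1 (by norm_num : (0 : ℝ) ≤ 1 / 4)
    rw [← hD] at this
    refine this.trans (le_of_eq ?_)
    rw [ht, ← Real.rpow_mul hB0.le]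
    norm_num
  have e3 : (D : ℝ) ^ (11 / 8 : ℝ) ≤ (B : ℝ) ^ (11 / 490 : ℝ) := by
    have := floor_rpow_le ht1 (by norm_num : (0 : ℝ) ≤ 11 / 8)
    rw [← hD] at this
    refine this.trans (le_of_eq ?_)
    rw [ht, ← Real.rpow_mul hB0.le]
    norm_num
  -- the three products are `≪ B^{734/735+ε}`
  set M : ℝ := (B : ℝ) ^ (734 / 735 + ε : ℝ) with hM
  have hM0 : 0 < M := Real.rpow_pos_of_pos hB0 _
  have p1 : (B : ℝ) ^ (1 + ε) * (D : ℝ) ^ (-(1 / 12 : ℝ)) ≤ (2 : ℝ) ^ (1 / 12 : ℝ) * M := by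
    calc (B : ℝ) ^ (1 + ε) * (D : ℝ) ^ (-(1 / 12 : ℝ))
        ≤ (B : ℝ) ^ (1 + ε) * ((2 : ℝ) ^ (1 / 12 : ℝ) * (B : ℝ) ^ (-(1 / 735 : ℝ))) :=
          mul_le_mul_of_nonneg_left e1 (by positivity)
      _ = (2 : ℝ) ^ (1 / 12 : ℝ) * ((B : ℝ) ^ (1 + ε) * (B : ℝ) ^ (-(1 / 735 : ℝ))) := by ring
      _ = (2 : ℝ) ^ (1 / 12 : ℝ) * M := by
          rw [← Real.rpow_add hB0, hM]; norm_num; ring_nf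
  have p2 : (B : ℝ) ^ (1 + ε) * (D : ℝ) ^ (-(1 / 4 : ℝ)) ≤ (2 : ℝ) ^ (1 / 4 : ℝ) * M := by
    calc (B : ℝ) ^ (1 + ε) * (D : ℝ) ^ (-(1 / 4 : ℝ))
        ≤ (B : ℝ) ^ (1 + ε) * ((2 : ℝ) ^ (1 / 4 : ℝ) * (B : ℝ) ^ (-(1 / 245 : ℝ))) :=
          mul_le_mul_of_nonneg_left e2 (by positivity)
      _ = (2 : ℝ) ^ (1 / 4 : ℝ) * ((B : ℝ) ^ (1 + ε) * (B : ℝ) ^ (-(1 / 245 : ℝ))) := by ring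
      _ = (2 : ℝ) ^ (1 / 4 : ℝ) * (B : ℝ) ^ (1 + ε + -(1 / 245 : ℝ)) := by
          rw [← Real.rpow_add hB0]
      _ ≤ (2 : ℝ) ^ (1 / 4 : ℝ) * M := by
          refine mul_le_mul_of_nonneg_left ?_ (by positivity)
          exact Real.rpow_le_rpow_of_exponent_le hB1 (by norm_num; linarith)
  have p3 : (B : ℝ) ^ (41 / 42 + ε : ℝ) * (D : ℝ) ^ (11 / 8 : ℝ) ≤ M := by
    calc (B : ℝ) ^ (41 / 42 + ε : ℝ) * (D : ℝ) ^ (11 / 8 : ℝ)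
        ≤ (B : ℝ) ^ (41 / 42 + ε : ℝ) * (B : ℝ) ^ (11 / 490 : ℝ) :=
          mul_le_mul_of_nonneg_left e3 (by positivity)
      _ = M := by rw [← Real.rpow_add hB0, hM]; norm_num; ring_nf
  -- `|N(D,B) − cB| ≤ C₂' (2^{1/4} + 1) M`
  have hmid' : |(mainCountTrunc B D : ℝ) - c * B| ≤ C₂' * (((2 : ℝ) ^ (1 / 4 : ℝ) + 1) * M) := by
    refine hmid.trans ?_
    have hsum : (B : ℝ) ^ (1 + ε) * (D : ℝ) ^ (-(1 / 4 : ℝ)) +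
        (B : ℝ) ^ (41 / 42 + ε : ℝ) * (D : ℝ) ^ (11 / 8 : ℝ) ≤ ((2 : ℝ) ^ (1 / 4 : ℝ) + 1) * M := by
      nlinarith [p2, p3]
    have hnn : 0 ≤ (B : ℝ) ^ (1 + ε) * (D : ℝ) ^ (-(1 / 4 : ℝ)) +
        (B : ℝ) ^ (41 / 42 + ε : ℝ) * (D : ℝ) ^ (11 / 8 : ℝ) := by positivity
    calc C₂ * ((B : ℝ) ^ (1 + ε) * (D : ℝ) ^ (-(1 / 4 : ℝ)) +
          (B : ℝ) ^ (41 / 42 + ε : ℝ) * (D : ℝ) ^ (11 / 8 : ℝ))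
        ≤ C₂' * ((B : ℝ) ^ (1 + ε) * (D : ℝ) ^ (-(1 / 4 : ℝ)) +
          (B : ℝ) ^ (41 / 42 + ε : ℝ) * (D : ℝ) ^ (11 / 8 : ℝ)) :=
          mul_le_mul_of_nonneg_right (le_max_left _ _) hnn
      _ ≤ C₂' * (((2 : ℝ) ^ (1 / 4 : ℝ) + 1) * M) :=
          mul_le_mul_of_nonneg_left hsum (le_max_right _ _)
  -- combine
  have hupp' : (mainCount B : ℝ) - mainCountTrunc B D ≤ C₁ * ((2 : ℝ) ^ (1 / 12 : ℝ) * M) := by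
    have : C₁ * (B : ℝ) ^ (1 + ε) * (D : ℝ) ^ (-(1 / 12 : ℝ)) ≤ C₁ * ((2 : ℝ) ^ (1 / 12 : ℝ) * M) := by
      rw [mul_assoc]; exact mul_le_mul_of_nonneg_left p1 hC₁.le
    linarith
  rw [abs_le] at hmid' ⊢
  constructor <;> nlinarith [hmid'.1, hmid'.2, hlow, hupp', hM0, le_max_right C₂ 0, hC₁]

/-- **Theorem 1.1 of Shute (2021) from its two inputs**: Prop. 3.1 and the truncated asymptotic
`|N(D, B) − cB| ≤ C_ε (B^{1+ε} D^{-1/4} + B^{41/42+ε} D^{11/8})` (`1 ≤ D ≤ B^{1/16}`) with a constant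
`c > 0` (positivity of `c`: (5.10) and Lemma 5.5) give `Shute2021_theorem11`. What is NOT supplied
here is exactly the circle-method input: Theorem 4.2 (= Thm. 1.3) applied at `𝐚 = 𝐬²𝐲³` and summed
with Lemmas 5.2–5.4 and 4.15, and `c > 0`. [cite: Shute2021, §5, last paragraph before §5.1] -/
theorem theorem11_of_truncated (h31 : Shute2021_prop31) {c : ℝ} (hc : 0 < c)
    (hmain : ∀ ε : ℝ, 0 < ε → ∃ C : ℝ, ∀ B D : ℕ, 1 ≤ B → 1 ≤ D →
      (D : ℝ) ≤ (B : ℝ) ^ (1 / 16 : ℝ) →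
        |(mainCountTrunc B D : ℝ) - c * B| ≤
          C * ((B : ℝ) ^ (1 + ε) * (D : ℝ) ^ (-(1 / 4 : ℝ)) +
            (B : ℝ) ^ (41 / 42 + ε : ℝ) * (D : ℝ) ^ (11 / 8 : ℝ))) :
    Shute2021_theorem11 :=
  ⟨c, hc, mainCount_sub_linear_le_of_truncated h31 hmain⟩

/-! ### Fibring over `𝐲` and the substitution `xᵢ ↦ sᵢxᵢ`: the counts `N_𝐚(B)` of (1.6) -/

/-- Shute's `N_𝐚(B)` of (1.6), restricted to positive `𝐱` (the paper counts `𝐱 ∈ (ℤ_{≠0})⁴`, which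
is `16` times this): the number of `𝐱 ∈ ℕ⁴`, `xᵢ ≥ 1`, with `a₁x₁² + ⋯ + a₄x₄² = 0` and
`|aᵢ| xᵢ² ≤ B` for all `i`. This is the quantity Theorem 1.3 / 4.2 evaluates asymptotically.
[cite: Shute2021, §1, (1.6)] -/
def posQuadCount (a : Fin 4 → ℤ) (B : ℕ) : ℕ :=
  #{x ∈ box (fun _ => B) | (∀ i, 0 < x i ∧ |a i| * x i ^ 2 ≤ (B : ℤ)) ∧ ∑ i, a i * x i ^ 2 = 0}

open Classical in
/-- The admissible vectors `𝐲` of `N(D, B)`: `yᵢ ≠ 0` square-free, `|yᵢ| ≤ B`, `y₁y₂y₃y₄ ≠ □` and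
`|y₁y₂y₃y₄| ≤ D` (the range of the `𝐲`-sum in (5.7)). [cite: Shute2021, §5, (5.7)] -/
def yVectors (B D : ℕ) : Finset (Fin 4 → ℤ) :=
  {y ∈ box (fun _ => B) | (∀ i, y i ≠ 0 ∧ Squarefree (y i).natAbs) ∧ ¬ IsSquare (∏ i, y i) ∧
    |∏ i, y i| ≤ (D : ℤ)}

/-- Shute's `N_𝐲(B; 𝐬, s₀)` of (5.6) (with `s₀` folded into `𝐬`): for fixed `𝐲` and `𝐬 ∈ ℕ⁴`, the
number of `𝐱 ∈ ℕ⁴` with `sᵢ ∣ xᵢ`, `|yᵢ³xᵢ²| ≤ B` and `Σ yᵢ³xᵢ² = 0`. [cite: Shute2021, §5, (5.6)] -/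
def fibreCount (B : ℕ) (y : Fin 4 → ℤ) (s : Fin 4 → ℕ) : ℕ :=
  #{x ∈ box (fun _ => B) |
    (∀ i, 0 < x i ∧ |y i ^ 3 * x i ^ 2| ≤ (B : ℤ) ∧ ((s i : ℕ) : ℤ) ∣ x i) ∧ ∑ i, y i ^ 3 * x i ^ 2 = 0}

/-- The multipliers `sᵢ = d / gcd(d, |yᵢ|)` of the corrected Lemma 5.2. [cite: Shute2021, §5
(display after (5.6))] -/
def sVec (d : ℕ) (y : Fin 4 → ℤ) : Fin 4 → ℕ := fun i => d / Nat.gcd d (y i).natAbs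

/-- `sᵢ ≥ 1` for `d ≥ 1`. [folklore] -/
theorem sVec_pos {d : ℕ} (hd : 0 < d) (y : Fin 4 → ℤ) (i : Fin 4) : 0 < sVec d y i :=
  Nat.div_pos (Nat.gcd_le_left _ hd) (Nat.gcd_pos_of_pos_left _ hd)

open Classical in
/-- **Fibring the parameter count over `𝐲`**: the `d`-th term of the corrected Lemma 5.2 is
`Σ_𝐲 N_𝐲(B; 𝐬(d, 𝐲))` over the admissible `𝐲` (cf. the first display after the proof of
Lemma 5.2). [cite: Shute2021, §5, (5.5)] -/
theorem card_params_dvd_eq_sum_fibreCount (B D d : ℕ) :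
    #{p ∈ paramBox B | IsParams B p ∧ (∀ i, ((d / Nat.gcd d (p.2 i).natAbs : ℕ) : ℤ) ∣ p.1 i) ∧
        ∑ i, p.2 i ^ 3 * p.1 i ^ 2 = 0 ∧ ¬ IsSquare (∏ i, p.2 i) ∧ |∏ i, p.2 i| ≤ (D : ℤ)} =
      ∑ y ∈ yVectors B D, fibreCount B y (sVec d y) := by
  set S := {p ∈ paramBox B | IsParams B p ∧ (∀ i, ((d / Nat.gcd d (p.2 i).natAbs : ℕ) : ℤ) ∣ p.1 i) ∧
    ∑ i, p.2 i ^ 3 * p.1 i ^ 2 = 0 ∧ ¬ IsSquare (∏ i, p.2 i) ∧ |∏ i, p.2 i| ≤ (D : ℤ)} with hS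
  have hmaps : Set.MapsTo Prod.snd (S : Set ((Fin 4 → ℤ) × (Fin 4 → ℤ))) (yVectors B D : Set _) := by
    intro p hp
    rw [Finset.mem_coe, hS, mem_filter, mem_paramBox] at hp
    rw [Finset.mem_coe, yVectors, mem_filter, mem_box]
    obtain ⟨⟨-, hy⟩, hP, -, -, hsq, hD⟩ := hp
    exact ⟨hy, fun i => ⟨(hP i).2.1, (hP i).2.2.1⟩, hsq, hD⟩
  rw [Finset.card_eq_sum_card_fiberwise hmaps]
  refine Finset.sum_congr rfl fun y hy => ?_
  rw [yVectors, mem_filter, mem_box] at hy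
  obtain ⟨hyB, hy0, hysq, hyD⟩ := hy
  -- the fibre over `y` is `{(x, y) : x counted by fibreCount}`
  unfold fibreCount
  refine Finset.card_bij (fun p _ => p.1) ?_ ?_ ?_
  · intro p hp
    rw [mem_filter, hS, mem_filter, mem_paramBox] at hp
    obtain ⟨⟨⟨hx, -⟩, hP, hdvd, hsum, -, -⟩, rfl⟩ := hp
    rw [mem_filter, mem_box]
    exact ⟨hx, fun i => ⟨(hP i).1, (hP i).2.2.2, hdvd i⟩, hsum⟩
  · intro p hp p' hp' h
    rw [mem_filter] at hp hp'
    exact Prod.ext h (hp.2.trans hp'.2.symm)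
  · intro x hx
    rw [mem_filter, mem_box] at hx
    obtain ⟨hxB, hxi, hsum⟩ := hx
    refine ⟨(x, y), ?_, rfl⟩
    rw [mem_filter, hS, mem_filter, mem_paramBox]
    exact ⟨⟨⟨hxB, hyB⟩, fun i => ⟨(hxi i).1, (hy0 i).1, (hy0 i).2, (hxi i).2.1⟩, fun i => (hxi i).2.2,
      hsum, hysq, hyD⟩, rfl⟩

/-- **The substitution `xᵢ ↦ sᵢxᵢ`**: for `yᵢ ≠ 0` and `sᵢ ≥ 1`,
`N_𝐲(B; 𝐬) = N⁺_{𝐬²𝐲³}(B)` ("we have `N_𝐲(B; 𝐬, s₀) = N_{𝐬²𝐲³}(B/s₀²)`"; here `s₀` is folded into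
`𝐬`). [cite: Shute2021, §5 (display after (5.6))] -/
theorem fibreCount_eq_posQuadCount {B : ℕ} {y : Fin 4 → ℤ} (hy : ∀ i, y i ≠ 0) {s : Fin 4 → ℕ}
    (hs : ∀ i, 0 < s i) :
    fibreCount B y s = posQuadCount (fun i => (s i : ℤ) ^ 2 * y i ^ 3) B := by
  have hs0 : ∀ i, (s i : ℤ) ≠ 0 := fun i => by exact_mod_cast (hs i).ne'
  have hs1 : ∀ i, (1 : ℤ) ≤ s i := fun i => by exact_mod_cast hs i
  -- `|y³ (s x)²| = |s² y³| x²`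
  have key : ∀ i (x : ℤ), |y i ^ 3 * ((s i : ℤ) * x) ^ 2| = |(s i : ℤ) ^ 2 * y i ^ 3| * x ^ 2 := by
    intro i x
    rw [show y i ^ 3 * ((s i : ℤ) * x) ^ 2 = ((s i : ℤ) ^ 2 * y i ^ 3) * x ^ 2 by ring, abs_mul,
      abs_of_nonneg (sq_nonneg x)]
  unfold fibreCount posQuadCount
  symm
  refine Finset.card_bij (fun x _ => fun i => (s i : ℤ) * x i) ?_ ?_ ?_
  · intro x hx
    rw [mem_filter, mem_box] at hx ⊢
    obtain ⟨-, hxi, hsum⟩ := hx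
    have hpos : ∀ i, 0 < (s i : ℤ) * x i := fun i => mul_pos (by exact_mod_cast hs i) (hxi i).1
    refine ⟨fun i => ?_, fun i => ⟨hpos i, ?_, dvd_mul_right _ _⟩, ?_⟩
    · -- `s x ≤ (s x)² ≤ |s² y³| x² ≤ B`
      have h1 : |(s i : ℤ) ^ 2 * y i ^ 3| * x i ^ 2 ≤ B := (hxi i).2
      have hy1 : (1 : ℤ) ≤ |y i ^ 3| := by
        rw [abs_pow]; exact one_le_pow₀ (Int.one_le_abs (hy i))
      rw [abs_of_pos (hpos i)]
      calc (s i : ℤ) * x i ≤ ((s i : ℤ) * x i) ^ 2 := by nlinarith [hpos i]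
        _ = (s i : ℤ) ^ 2 * 1 * x i ^ 2 := by ring
        _ ≤ (s i : ℤ) ^ 2 * |y i ^ 3| * x i ^ 2 := by gcongr
        _ = |(s i : ℤ) ^ 2 * y i ^ 3| * x i ^ 2 := by
            rw [abs_mul, abs_of_nonneg (sq_nonneg ((s i : ℤ)))]
        _ ≤ B := h1
    · rw [key]; exact (hxi i).2
    · rw [← hsum]; exact Finset.sum_congr rfl fun i _ => by ring
  · intro x hx x' hx' h
    funext i
    have := congrFun h i
    exact mul_left_cancel₀ (hs0 i) this
  · intro x hx
    rw [mem_filter, mem_box] at hx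
    obtain ⟨hxB, hxi, hsum⟩ := hx
    choose x' hx' using fun i => (hxi i).2.2
    refine ⟨x', ?_, funext fun i => (hx' i).symm⟩
    rw [mem_filter, mem_box]
    have hx'pos : ∀ i, 0 < x' i := fun i => by
      have := (hxi i).1; rw [hx' i] at this
      exact pos_of_mul_pos_right this (by exact_mod_cast (hs i).le)
    refine ⟨fun i => ?_, fun i => ⟨hx'pos i, ?_⟩, ?_⟩
    · calc |x' i| = x' i := abs_of_pos (hx'pos i)
        _ ≤ (s i : ℤ) * x' i := le_mul_of_one_le_left (hx'pos i).le (hs1 i)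
        _ = |x i| := by rw [hx' i, abs_of_pos]; rw [← hx' i]; exact (hxi i).1
        _ ≤ B := hxB i
    · rw [← key, ← hx' i]; exact (hxi i).2.1
    · rw [← hsum]; exact Finset.sum_congr rfl fun i _ => by rw [hx' i]; ring

open Classical in
/-- **`N(D, B)` as a Möbius-weighted sum of the counts `N⁺_𝐚(B)` that Theorem 1.3 evaluates**
(corrected Lemma 5.2 + the fibration over `𝐲` + the substitution `xᵢ ↦ sᵢxᵢ`):
`N(D, B) = Σ_{d ≤ B, d square-free} μ(d) Σ_{𝐲 admissible} N⁺_{𝐬(d,𝐲)²𝐲³}(B)`, `sᵢ = d / gcd(d, |yᵢ|)`.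
This is the exact point of §5 at which the circle-method input (Theorem 4.2 with `𝐚 = 𝐬²𝐲³`,
(5.7)) enters. [cite: Shute2021, §5, Lemma 5.2–(5.7)] -/
theorem mainCountTrunc_eq_sum_moebius_posQuadCount (B D : ℕ) :
    (mainCountTrunc B D : ℤ) = ∑ d ∈ (Icc 1 B).filter Squarefree, (μ d : ℤ) *
      ∑ y ∈ yVectors B D, (posQuadCount (fun i => (sVec d y i : ℤ) ^ 2 * y i ^ 3) B : ℤ) := by
  rw [mainCountTrunc_eq_sum_moebius_squarefree]
  refine Finset.sum_congr rfl fun d hd => ?_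
  rw [mem_filter, mem_Icc] at hd
  congr 1
  rw [card_params_dvd_eq_sum_fibreCount, Nat.cast_sum]
  refine Finset.sum_congr rfl fun y hy => ?_
  rw [yVectors, mem_filter] at hy
  rw [fibreCount_eq_posQuadCount (fun i => (hy.2.1 i).1) (sVec_pos hd.1.1 y)]

end Shute2021

end Literature.NumberTheory.DiophantineGeometry
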